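import Summits.BirchSwinnertonDyer.BirchSwinnertonDyer.Theorems.ThetaPartnerAtTwoSignedMainConjectureCMTwoRankZero
import HarnessLib

/-!
# Route `ThetaPartnerAtTwo`, crux K2 `SignedMainConjectureCMTwo` (item stmt-BirchSwinnertonDyer-20307):
# rank-zero rigidity, KATO DIRECTION, and the composition "parts ⇒ K2 restricted to analytic rank 0"

HONEST FRAMING (cell `pub/bsd-wall`, W-ALL row 1, prover seat `bsd-wall-tp2-p2`, successor g1):
companion of `ThetaPartnerAtTwoSignedMainConjectureCMTwoRankZero.lean` (file A; route-independent, as is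
this file). Nothing of the crux is proved; every research input is a displayed binder.

* §1 `kobayashiMainConjecture_two_one_conclusion_of_upperDivisibility` — file A's §2 with the KATO
  half `ι(g·h) = ϖ·ι L⁻` (crux K3 `SignedKatoDivisibilityUpToAtTwo`'s shape at `m = 0`) in place of the
  Eisenstein half: at a curve with `L(W,1) ≠ 0`, BSD₂(W), GZK and Kim's control term at `2`, ONE exact
  upper divisibility gives the conclusion of `KobayashiMainConjecture W 2 1` at the data (file A §0–§1).
* §2 `signedMainConjectureCMTwo_at_rankZero_of_upperDivisibility` — the CM rank-`0` assembly of file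
  A §4 with (E) replaced by the Kato half for `A` (`m = 0`): `KobayashiMainConjecture A 2 1` and, at
  normalised pairs, torsion ∧ `μ⁺ = 0`.
* §3 `signedMainConjectureCMTwo_rankZero_of_parts` — CLASS-WIDE composition: PUB (Burungale–Flach,
  modularity ×2, GZK, by name) + for every CM `A` good supersingular at `2` with `a₂ = 0` and
  `A.analyticRank = 0`: (T2) torsion of every signed dual datum, (K4c) Kim's control term at `2`, (E)
  `KobayashiLowerDivisibility A 2 1`, (μ_an) `ord₂ ϖ_A = 0 ∧ L♭_A has a unit coefficient`, and (GC)
  signed generator change for `μ = 0` (from normalised pairs to all top-generator pairs — the signed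
  copy of the tree's `IwasawaGeneratorChangeProofs`, not in the tree) ⇒ the crux K2 RESTRICTED to
  `A.analyticRank = 0`, verbatim — the hypothesis `hCMr` of the sibling
  `nonCMAtTwo_of_signedMainConjectureCMTwo_rankZero` (file `…RankZeroSuffices.lean`), which re-proves
  the route's `closes` from it. So: route target ⇐ PUB + K1 + [(T2)+(K4c)+(E)+(μ_an)+(GC) for CM
  rank-0 partners] + K3 + K4 + residual, kernel-checked end to end.

References: [Kobayashi2003] Thm. 1.2, 1.3, Conjecture p. 2; [BDKim2013] Cor. 3.15; [PollackRubin2004]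
Thm. 7.3; [BurungaleFlach2024] Thm. 1.1; [Sprung2017] Thm. 1.12; [Washington1997] §7.1; [Miller2011LMS] Def. 1.1.
-/

set_option autoImplicit false
-- the Theorems namespace of this sub repeats the summit name by design (D-0017 nested layout)
set_option linter.dupNamespace false

noncomputable section

open scoped Classical MatrixGroups ModularForm

open CongruenceSubgroup WeierstrassCurve Literature.NumberTheory.EllipticCurves
  Literature.NumberTheory.EllipticCurves.ModularForms Literature.NumberTheory.EllipticCurves.Sprung2017
  Literature.NumberTheory.EllipticCurves.Rank1Residual Literature.NumberTheory.EllipticCurves.Rank1Residual.Typed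
  Literature.NumberTheory.EllipticCurves.Kobayashi2003 ZpExtension
  Summit.BirchSwinnertonDyer.Rank1Residual Summit.BirchSwinnertonDyer.Rank1Residual.Supersingular

namespace Summit.BirchSwinnertonDyer.BirchSwinnertonDyer.Theorems

variable (A : WeierstrassCurve ℚ) [A.IsElliptic] [A.IsGloballyMinimal]

/-! ## §0. The `T = 0` valuation identity (private copy, as in file A) -/

section TrivialCharacter

/-- `ord₂ g(0) = ord₂ L(E,1)/Ω_E` from BSD₂ + GZK + Kim's control term at `2` — private copy of
`valuation_constantCoeff_generator_eq_of_bsdp_two` (p509213 §4, route cone), as in file A §0.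
[cite: BDKim2013, Cor. 3.15 (p. 199; p odd in print)] [cite: Miller2011LMS, Def. 1.1] -/
private theorem valuation_constantCoeff_generator_aux'
    (hGZK : rank_eq_analyticRank_of_analyticRank_le_one)
    (hss : GoodSS A 2) (hL : A.entireLFunction 1 ≠ 0) (hBSD : BSDp A 2)
    (hKim : ∀ (κ : ZpExtension ℚ 2) (γ : Field.absoluteGaloisGroup ℚ),
      κ.IsCyclotomic → κ.IsTopGenerator γ →
      ∀ (D : SignedSelmerDualData A κ γ 1) [Module.Finite (IwasawaAlgebra 2) D.X],
        Module.IsTorsion (IwasawaAlgebra 2) D.X →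
      ∀ g : IwasawaAlgebra 2, D.charIdeal = Ideal.span {g} → Finite (A.selmerGroupPInfty 2) →
        ∃ u : ℤ_[2]ˣ, ((PowerSeries.constantCoeff g : ℤ_[2]) : ℚ_[2]) =
          ((u : ℤ_[2]) : ℚ_[2]) * ((2 : ℕ) : ℚ_[2]) ^ (padicValNat 2 A.tamagawaProduct) *
            (Nat.card (A.selmerGroupPInfty 2) : ℚ_[2]))
    {κ : ZpExtension ℚ 2} {γ : Field.absoluteGaloisGroup ℚ} (hκ : κ.IsCyclotomic)
    (hγ : κ.IsTopGenerator γ) (D : SignedSelmerDualData A κ γ 1)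
    [Module.Finite (IwasawaAlgebra 2) D.X] (hTors : Module.IsTorsion (IwasawaAlgebra 2) D.X)
    {g : IwasawaAlgebra 2} (hchar : D.charIdeal = Ideal.span {g})
    {t : ℚ} (ht : A.entireLFunction 1 / (A.realPeriodRat : ℂ) = (t : ℂ)) :
    ((PowerSeries.constantCoeff g : ℤ_[2]) : ℚ_[2]) ≠ 0 ∧
      (((PowerSeries.constantCoeff g : ℤ_[2]) : ℚ_[2])).valuation = padicValRat 2 t := by
  have hr : A.analyticRank = 0 := analyticRank_eq_zero_of_entireLFunction_one_ne_zero A hL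
  have hirr : A.HasIrreducibleModPGaloisRep 2 := P2.irr_two_of_goodSS_two A hss
  have hΩ : (A.realPeriodRat : ℂ) ≠ 0 := Complex.ofReal_ne_zero.mpr A.realPeriodRat_pos_holds.ne'
  have ht0 : t ≠ 0 := by
    rintro rfl
    apply hL
    have h := ht
    rw [div_eq_iff hΩ] at h
    rw [h]
    simp
  have hK : (⟨g, 0, 0⟩ : SignedDatum A 2).EulerCharacteristic := fun hfin ↦
    hKim κ γ hκ hγ D hTors g hchar hfin
  obtain ⟨hne, hvg⟩ := valuation_constantCoeff_xi A 2 hGZK hL ⟨g, 0, 0⟩ hK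
  haveI : Finite A.sha := (hGZK A (by omega)).2
  obtain ⟨q, hq, hv⟩ := missingPPartAt_of_bsdp A 2 hBSD
  have hsha := shaAn_eq_of_analyticRank_eq_zero A hGZK hr ht
  have hqt : q = t * (A.torsionOrder : ℚ) ^ 2 / (A.tamagawaProduct : ℚ) := by
    have h := hq.symm.trans hsha
    exact_mod_cast h
  rw [hqt, padicValRat_shaAn_witness A 2 hirr ht0] at hv
  refine ⟨hne, ?_⟩
  rw [hvg]
  linarith

end TrivialCharacter

/-! ## §1. The Kato direction at one datum -/

section Kato

/-- **The conclusion of the `+` main conjecture at `2` from its KATO HALF (exact, `m = 0`), at a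
curve with `L(W,1) ≠ 0` and BSD₂ known** — same setting as
`kobayashiMainConjecture_two_one_conclusion_of_lowerDivisibility`, with the divisibility
`ι(g·h) = ϖ·ι L⁻` (crux K3 `SignedKatoDivisibilityUpToAtTwo`'s shape at `m = 0`) instead.
[cite: Kobayashi2003, Conjecture (p. 2) and Thm. 1.3] [cite: BDKim2013, Cor. 3.15 (p odd in print)]
[cite: Miller2011LMS, Def. 1.1] -/
theorem kobayashiMainConjecture_two_one_conclusion_of_upperDivisibility
    (hGZK : rank_eq_analyticRank_of_analyticRank_le_one)
    (hss : GoodSS A 2) (ha : A.frobeniusTrace 2 = 0) (hL : A.entireLFunction 1 ≠ 0)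
    (hBSD : BSDp A 2)
    (hKim : ∀ (κ : ZpExtension ℚ 2) (γ : Field.absoluteGaloisGroup ℚ),
      κ.IsCyclotomic → κ.IsTopGenerator γ →
      ∀ (D : SignedSelmerDualData A κ γ 1) [Module.Finite (IwasawaAlgebra 2) D.X],
        Module.IsTorsion (IwasawaAlgebra 2) D.X →
      ∀ g : IwasawaAlgebra 2, D.charIdeal = Ideal.span {g} → Finite (A.selmerGroupPInfty 2) →
        ∃ u : ℤ_[2]ˣ, ((PowerSeries.constantCoeff g : ℤ_[2]) : ℚ_[2]) =
          ((u : ℤ_[2]) : ℚ_[2]) * ((2 : ℕ) : ℚ_[2]) ^ (padicValNat 2 A.tamagawaProduct) *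
            (Nat.card (A.selmerGroupPInfty 2) : ℚ_[2]))
    {κ : ZpExtension ℚ 2} {γ : Field.absoluteGaloisGroup ℚ} (hκ : κ.IsCyclotomic)
    (hγ : κ.IsTopGenerator γ) (D : SignedSelmerDualData A κ γ 1)
    [Module.Finite (IwasawaAlgebra 2) D.X] (hTors : Module.IsTorsion (IwasawaAlgebra 2) D.X)
    [NeZero (A.conductorNorm ℤ)] {f : CuspForm (Gamma0 (A.conductorNorm ℤ)) 2} (hf : IsNewformOf A f)
    {ϖ : ℚ} (hϖ : (ϖ : ℝ) * A.realPeriodRat = plusPeriod f)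
    {Lplus Lminus : IwasawaAlgebra 2} (hPP : IsPollackPair f 2 Lplus Lminus)
    {g h : IwasawaAlgebra 2} (hchar : D.charIdeal = Ideal.span {g})
    (hdiv : iwasawaToPowerSeries 2 (g * h) =
      PowerSeries.C (ϖ : ℚ_[2]) * iwasawaToPowerSeries 2 (kobayashiL 1 Lplus Lminus)) :
    ∃ g' : IwasawaAlgebra 2, D.charIdeal = Ideal.span {g'} ∧
      iwasawaToPowerSeries 2 g' =
        PowerSeries.C (ϖ : ℚ_[2]) * iwasawaToPowerSeries 2 (kobayashiL 1 Lplus Lminus) := by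
  obtain ⟨hΦ0, ht⟩ := constantCoeff_neronPlus_two_eq A hf hss.1 ha hϖ hPP
  obtain ⟨hg0, hval⟩ := valuation_constantCoeff_generator_aux' A hGZK hss hL hBSD hKim hκ hγ D hTors hchar ht
  have ht0 : ϖ * ratPlusSymbol f 0 ≠ 0 := by
    intro h0
    apply hL
    have h := ht
    rw [h0, div_eq_iff (Complex.ofReal_ne_zero.mpr A.realPeriodRat_pos_holds.ne')] at h
    rw [h]
    simp
  refine exists_generator_eq_of_mul_eq_of_valuation_constantCoeff_eq hchar hdiv ?_ ?_
  · rw [hΦ0]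
    exact_mod_cast ht0
  · rw [hval, hΦ0, Padic.valuation_ratCast]


/-! ## §2. The CM rank-`0` assembly from the Kato half -/

/-- **Crux K2 at a CM curve of analytic rank `0`, at the normalised pairs, from its KATO half** — file
A's `signedMainConjectureCMTwo_at_rankZero_of_lowerDivisibility` with (E) replaced by the exact upper
divisibility `hup` for `A` (crux K3's shape with `m = 0`, read for the CM curve).
[cite: BurungaleFlach2024, Thm. 1.1] [cite: Kobayashi2003, Thm. 1.2, Thm. 1.3 and Conjecture (p. 2)]
[cite: BDKim2013, Cor. 3.15 (p odd in print)] -/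
theorem signedMainConjectureCMTwo_at_rankZero_of_upperDivisibility
    (hBF : bsdTriple_of_hasCM_of_L_one_ne_zero)
    (hmod : nonempty_modularParametrizationData) (hLrat : hasEntireLFunction_rat)
    (hGZK : rank_eq_analyticRank_of_analyticRank_le_one)
    (hcm : A.HasCM) (hss : GoodSS A 2) (ha : A.frobeniusTrace 2 = 0) (hr : A.analyticRank = 0)
    (hT2 : ∀ (κ : ZpExtension ℚ 2) (γ : Field.absoluteGaloisGroup ℚ),
      κ.IsCyclotomic → κ.IsTopGenerator γ →
      ∀ D : SignedSelmerDualData A κ γ 1, Module.IsTorsion (IwasawaAlgebra 2) D.X)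
    (hKim : ∀ (κ : ZpExtension ℚ 2) (γ : Field.absoluteGaloisGroup ℚ),
      κ.IsCyclotomic → κ.IsTopGenerator γ →
      ∀ (D : SignedSelmerDualData A κ γ 1) [Module.Finite (IwasawaAlgebra 2) D.X],
        Module.IsTorsion (IwasawaAlgebra 2) D.X →
      ∀ g : IwasawaAlgebra 2, D.charIdeal = Ideal.span {g} → Finite (A.selmerGroupPInfty 2) →
        ∃ u : ℤ_[2]ˣ, ((PowerSeries.constantCoeff g : ℤ_[2]) : ℚ_[2]) =
          ((u : ℤ_[2]) : ℚ_[2]) * ((2 : ℕ) : ℚ_[2]) ^ (padicValNat 2 A.tamagawaProduct) *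
            (Nat.card (A.selmerGroupPInfty 2) : ℚ_[2]))
    (hup : ∀ (κ : ZpExtension ℚ 2) (γ : Field.absoluteGaloisGroup ℚ),
      κ.IsCyclotomic → κ.IsTopGenerator γ → IsCyclotomicVariable 2 γ →
      ∀ [NeZero (A.conductorNorm ℤ)] (f : CuspForm (Gamma0 (A.conductorNorm ℤ)) 2),
        IsNewformOf A f → ∀ (ϖ : ℚ), (ϖ : ℝ) * A.realPeriodRat = plusPeriod f →
      ∀ (Lplus Lminus : IwasawaAlgebra 2), IsPollackPair f 2 Lplus Lminus →
      ∀ (D : SignedSelmerDualData A κ γ 1),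
        ∃ g h : IwasawaAlgebra 2, D.charIdeal = Ideal.span {g} ∧
          iwasawaToPowerSeries 2 (g * h) =
            PowerSeries.C (ϖ : ℚ_[2]) * iwasawaToPowerSeries 2 (kobayashiL 1 Lplus Lminus))
    (hμan : ∀ [NeZero (A.conductorNorm ℤ)] (f : CuspForm (Gamma0 (A.conductorNorm ℤ)) 2),
      IsNewformOf A f → ∀ (ϖ : ℚ), (ϖ : ℝ) * A.realPeriodRat = plusPeriod f →
      ∀ (Lplus Lminus : IwasawaAlgebra 2), IsPollackPair f 2 Lplus Lminus →
        padicValRat 2 ϖ = 0 ∧ ∃ n : ℕ, IsUnit (PowerSeries.coeff n (kobayashiL 1 Lplus Lminus))) :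
    KobayashiMainConjecture A 2 1 ∧
    ∀ (κ : ZpExtension ℚ 2) (γ : Field.absoluteGaloisGroup ℚ),
      κ.IsCyclotomic → κ.IsTopGenerator γ → IsCyclotomicVariable 2 γ →
      ∀ D : SignedSelmerDualData A κ γ 1, Module.IsTorsion (IwasawaAlgebra 2) D.X ∧ D.mu = 0 := by
  have hL : A.entireLFunction 1 ≠ 0 := (A.analyticRank_eq_zero_iff_holds (hLrat A)).mp hr
  have hBSD : BSDp A 2 :=
    forall_bsdp_of_bsdTriple A A.tamagawaProduct_pos_holds (hBF A hcm hL) 2 Nat.prime_two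
  have hMC : KobayashiMainConjecture A 2 1 := by
    intro κ γ hκ hγ hγ' _ f hf ϖ hϖ Lplus Lminus hPP D
    haveI := Kobayashi2003.SignedSelmerDualData.moduleFinite hγ D
    have hTors := hT2 κ γ hκ hγ D
    obtain ⟨g, h, hchar, hdiv⟩ := hup κ γ hκ hγ hγ' f hf ϖ hϖ Lplus Lminus hPP D
    exact ⟨hTors, kobayashiMainConjecture_two_one_conclusion_of_upperDivisibility A hGZK hss ha hL hBSD
      hKim hκ hγ D hTors hf hϖ hPP hchar hdiv⟩
  refine ⟨hMC, fun κ γ hκ hγ hγ' D => ?_⟩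
  haveI := Kobayashi2003.SignedSelmerDualData.moduleFinite hγ D
  have hTors := hT2 κ γ hκ hγ D
  refine ⟨hTors, ?_⟩
  haveI : NeZero (A.conductorNorm ℤ) := ⟨(A.conductorNorm_pos_holds).ne'⟩
  obtain ⟨Dm⟩ := hmod A
  obtain ⟨ϖ, hϖpos, hϖeq, -⟩ := Dm.exists_rat_mul_realPeriodRat_eq_plusPeriod
  obtain ⟨Ls, Lf, -, hPP⟩ := exists_isPollackPair_two Dm.isNewformOf hss.1 ha hL
  obtain ⟨-, g, hchar, hg⟩ := hMC κ γ hκ hγ hγ' Dm.f Dm.isNewformOf ϖ hϖeq Ls Lf hPP D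
  obtain ⟨hϖv, hμ⟩ := hμan Dm.f Dm.isNewformOf ϖ hϖeq Ls Lf hPP
  exact muInvariant_eq_zero_of_generator_map_eq_C_mul D.X hTors hchar hϖpos.ne' hϖv hμ hg


end Kato

/-! ## §3. Class-wide composition: parts ⇒ the crux restricted to analytic rank `0` -/

section Parts

/-- **(T2)+(K4c)+(E)+(μ_an)+(GC) for CM rank-`0` curves + PUB ⇒ crux K2 restricted to
`A.analyticRank = 0`, verbatim.** Class-wide binders (each ∀ over CM `A/ℚ`, globally minimal, good
supersingular at `2`, `a₂ = 0`, `A.analyticRank = 0`): `hT2` torsion of every signed dual datum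
(Kobayashi Thm. 1.2 torsion half at `2`), `hKim` Kim's control term at `2` (crux K4c conjunct 2 read
for `A`), `hlow` the Eisenstein half `KobayashiLowerDivisibility A 2 1`, `hμan` the analytic `μ`
(`ord₂ ϖ = 0` and a unit coefficient of Kobayashi's `L⁺ = L♭`, for every newform/period/Pollack datum
of `A`), `hgen` signed generator change for `μ = 0` (normalised pairs ⇒ all top-generator pairs, given
torsion; the signed analogue of the tree's unsigned `IwasawaGeneratorChangeProofs`); PUB by name:
`hBF` (Burungale–Flach), `hmod`, `hLrat` (modularity), `hGZK`. Conclusion: the hypothesis `hCMr` of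
`nonCMAtTwo_of_signedMainConjectureCMTwo_rankZero` (sibling `…RankZeroSuffices.lean`). Pure
composition of file A §4; nothing asserted. [cite: PollackRubin2004, Thm. 7.3 (p > 2 in print)]
[cite: Kobayashi2003, Thm. 1.2 and Conjecture (p. 2)] [cite: BurungaleFlach2024, Thm. 1.1] -/
theorem signedMainConjectureCMTwo_rankZero_of_parts
    (hBF : bsdTriple_of_hasCM_of_L_one_ne_zero)
    (hmod : nonempty_modularParametrizationData) (hLrat : hasEntireLFunction_rat)
    (hGZK : rank_eq_analyticRank_of_analyticRank_le_one)
    (hT2 : ∀ (A : WeierstrassCurve ℚ) [A.IsElliptic] [A.IsGloballyMinimal],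
      A.HasCM → A.analyticRank = 0 → GoodSS A 2 → A.frobeniusTrace 2 = 0 →
      ∀ (κ : ZpExtension ℚ 2) (γ : Field.absoluteGaloisGroup ℚ), κ.IsCyclotomic → κ.IsTopGenerator γ →
      ∀ D : SignedSelmerDualData A κ γ 1, Module.IsTorsion (IwasawaAlgebra 2) D.X)
    (hKim : ∀ (A : WeierstrassCurve ℚ) [A.IsElliptic] [A.IsGloballyMinimal],
      A.HasCM → A.analyticRank = 0 → GoodSS A 2 → A.frobeniusTrace 2 = 0 →
      ∀ (κ : ZpExtension ℚ 2) (γ : Field.absoluteGaloisGroup ℚ), κ.IsCyclotomic → κ.IsTopGenerator γ →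
      ∀ (D : SignedSelmerDualData A κ γ 1) [Module.Finite (IwasawaAlgebra 2) D.X],
        Module.IsTorsion (IwasawaAlgebra 2) D.X →
      ∀ g : IwasawaAlgebra 2, D.charIdeal = Ideal.span {g} → Finite (A.selmerGroupPInfty 2) →
        ∃ u : ℤ_[2]ˣ, ((PowerSeries.constantCoeff g : ℤ_[2]) : ℚ_[2]) =
          ((u : ℤ_[2]) : ℚ_[2]) * ((2 : ℕ) : ℚ_[2]) ^ (padicValNat 2 A.tamagawaProduct) *
            (Nat.card (A.selmerGroupPInfty 2) : ℚ_[2]))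
    (hlow : ∀ (A : WeierstrassCurve ℚ) [A.IsElliptic] [A.IsGloballyMinimal],
      A.HasCM → A.analyticRank = 0 → GoodSS A 2 → A.frobeniusTrace 2 = 0 →
      KobayashiLowerDivisibility A 2 1)
    (hμan : ∀ (A : WeierstrassCurve ℚ) [A.IsElliptic] [A.IsGloballyMinimal],
      A.HasCM → A.analyticRank = 0 → GoodSS A 2 → A.frobeniusTrace 2 = 0 →
      ∀ [NeZero (A.conductorNorm ℤ)] (f : CuspForm (Gamma0 (A.conductorNorm ℤ)) 2),
      IsNewformOf A f → ∀ (ϖ : ℚ), (ϖ : ℝ) * A.realPeriodRat = plusPeriod f →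
      ∀ (Lplus Lminus : IwasawaAlgebra 2), IsPollackPair f 2 Lplus Lminus →
        padicValRat 2 ϖ = 0 ∧ ∃ n : ℕ, IsUnit (PowerSeries.coeff n (kobayashiL 1 Lplus Lminus)))
    (hgen : ∀ (A : WeierstrassCurve ℚ) [A.IsElliptic] [A.IsGloballyMinimal],
      A.HasCM → A.analyticRank = 0 → GoodSS A 2 → A.frobeniusTrace 2 = 0 →
      (∀ (κ : ZpExtension ℚ 2) (γ : Field.absoluteGaloisGroup ℚ),
        κ.IsCyclotomic → κ.IsTopGenerator γ → IsCyclotomicVariable 2 γ →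
        ∀ D : SignedSelmerDualData A κ γ 1, D.mu = 0) →
      ∀ (κ : ZpExtension ℚ 2) (γ : Field.absoluteGaloisGroup ℚ), κ.IsCyclotomic → κ.IsTopGenerator γ →
      ∀ D : SignedSelmerDualData A κ γ 1, D.mu = 0) :
    ∀ (A : WeierstrassCurve ℚ) [A.IsElliptic] [A.IsGloballyMinimal],
      A.HasCM → A.analyticRank = 0 → GoodSS A 2 → A.frobeniusTrace 2 = 0 →
      (∀ (κ : ZpExtension ℚ 2) (γ : Field.absoluteGaloisGroup ℚ),
        κ.IsCyclotomic → κ.IsTopGenerator γ →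
        ∀ D : SignedSelmerDualData A κ γ 1, Module.IsTorsion (IwasawaAlgebra 2) D.X ∧ D.mu = 0) ∧
      KobayashiMainConjecture A 2 1 := by
  intro A _ _ hcm hr hss ha
  obtain ⟨hMC, hnorm⟩ := signedMainConjectureCMTwo_at_rankZero_of_lowerDivisibility A hBF hmod hLrat
    hGZK hcm hss ha hr (hT2 A hcm hr hss ha) (hKim A hcm hr hss ha) (hlow A hcm hr hss ha)
    (hμan A hcm hr hss ha)
  refine ⟨fun κ γ hκ hγ D => ⟨hT2 A hcm hr hss ha κ γ hκ hγ D, ?_⟩, hMC⟩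
  exact hgen A hcm hr hss ha (fun κ₀ γ₀ hκ₀ hγ₀ hγ₀' D₀ => (hnorm κ₀ γ₀ hκ₀ hγ₀ hγ₀' D₀).2) κ γ hκ hγ D

end Parts

end Summit.BirchSwinnertonDyer.BirchSwinnertonDyer.Theorems

end
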